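import Mathlib
import Summits.Ventures.PercRepro2.Defs
import Summits.Ventures.PercRepro2.Graph
import Summits.Ventures.PercRepro2.Harris
import Summits.Ventures.PercRepro2.Events
import Summits.Ventures.PercRepro2.Induced
import Summits.Ventures.PercRepro2.HullTree
import Summits.Ventures.PercRepro2.SideCluster

/-!
# The root-cluster law of a forest is log-modular: `ClusterLogSupermod` on forests (blind cell
PercRepro2, mine-c g8; proofs/MINEC-LSMGATE.md §11; mine-1's hypothesis in `SideCluster.lean`)
On a forest (`Hull.IsForest ends`: `ends` injective, the graph of all edges acyclic; loops allowed)
the cluster of `s` is a rooted subtree `W` (`IsRootedSub`: `s ∈ W` and every vertex of `W` is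
joined to `s` by a walk of the all-open graph inside `W`), and for such `W`

  `{C(s) = W} = {every non-loop edge inside W open} ∩ {every boundary edge closed}`

(`clusterEvent_eq_cylinder`), so `P(C(s) = W) = ∏_e edgeFac W e` with `edgeFac W e = p_e / (1 − p_e)
/ 1` according as both / one / no endpoint of the non-loop edge `e` lies in `W` (loops contribute
`1`; `clusterMass_eq_prod`). Two rooted subtrees containing `s` have no edge between `W₁ ∖ W₂` and
`W₂ ∖ W₁` (`no_cross_edge`: path uniqueness), their intersection is a rooted subtree
(`inter_rooted`), and each edge factor is then MODULAR under `∩, ∪` (`edgeFac_mul`), whence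
`P(C = W₁) P(C = W₂) = P(C = W₁ ∩ W₂) P(C = W₁ ∪ W₂)` for rooted subtrees and `≤` trivially
otherwise (a set that is not a rooted subtree has zero mass): **`clusterLogSupermod_of_isForest`**;
with mine-1's `sideIneq_of_clusterLogSupermod`, (SIDE) on every forest is unconditional. -/

namespace Summit.Ventures.PercRepro2

namespace ForestCluster

open scoped Classical

variable {V : Type*} {E : Type*} [Fintype E] [Fintype V]

/-- The graph of all edges. -/
abbrev allG (ends : E → Sym2 V) : SimpleGraph V := openGraph ends (fun _ => true)

/-- `W` is a rooted subtree: it contains `s` and every vertex of `W` is joined to `s` by a walk of the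
graph of all edges whose support lies in `W`. -/
def IsRootedSub (ends : E → Sym2 V) (s : V) (W : Finset V) : Prop :=
  s ∈ W ∧ ∀ x ∈ W, ∃ q : (allG ends).Walk s x, ∀ v ∈ q.support, v ∈ W

omit [Fintype E] [Fintype V] in
/-- Every vertex on an open walk from `s` lies in the cluster of `s`. -/
lemma mem_cluster_of_mem_support {ends : E → Sym2 V} {ω : Config E} {s x : V}
    (w : (openGraph ends ω).Walk s x) {v : V} (hv : v ∈ w.support) : v ∈ cluster ends ω s :=
  ⟨w.takeUntil v hv⟩

omit [Fintype E] [Fintype V] in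
/-- The cluster of `s` (as a finset) is a rooted subtree. -/
lemma isRootedSub_of_clusterEvent {ends : E → Sym2 V} {ω : Config E} {s : V} {W : Finset V}
    (h : ω ∈ clusterEvent ends s (↑W : Set V)) : IsRootedSub ends s W := by
  rw [mem_clusterEvent] at h
  refine ⟨?_, fun x hx => ?_⟩
  · have : s ∈ cluster ends ω s := mem_cluster_self ends ω s
    rw [h] at this; exact Finset.mem_coe.mp this
  · have hx' : x ∈ cluster ends ω s := by rw [h]; exact Finset.mem_coe.mpr hx
    obtain ⟨w⟩ := hx'
    have hle : openGraph ends ω ≤ allG ends := openGraph_mono (Hull.le_allOpen ω)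
    refine ⟨w.mapLe hle, fun v hv => ?_⟩
    have hv' : v ∈ w.support := by
      rw [SimpleGraph.Walk.support_mapLe_eq_support] at hv; exact hv
    have := mem_cluster_of_mem_support w hv'
    rw [h] at this; exact Finset.mem_coe.mp this

omit [Fintype E] [Fintype V] in
/-- A closed non-loop edge of a forest separates its endpoints in every configuration. -/
lemma not_conn_of_closed {ends : E → Sym2 V} (hF : Hull.IsForest ends) {ω : Config E} {e : E}
    {x y : V} (hxy : ends e = s(x, y)) (hne : x ≠ y) (he : ω e = false) : ¬ Conn ends ω x y := by
  intro hc
  have hadj : (allG ends).Adj x y := openGraph_adj.2 ⟨hne, e, rfl, hxy⟩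
  have hbr : (allG ends).IsBridge s(x, y) :=
    (SimpleGraph.isAcyclic_iff_forall_adj_isBridge.1 hF.2) hadj
  rw [SimpleGraph.isBridge_iff] at hbr
  apply hbr
  have hle : openGraph ends ω ≤ (allG ends).deleteEdges {s(x, y)} := by
    intro a b hab
    obtain ⟨hne', e', he', hends'⟩ := openGraph_adj.1 hab
    rw [SimpleGraph.deleteEdges_adj]
    refine ⟨openGraph_adj.2 ⟨hne', e', rfl, hends'⟩, ?_⟩
    intro hmem
    rw [Set.mem_singleton_iff] at hmem
    have : e' = e := hF.1 (hends'.trans (hmem.trans hxy.symm))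
    rw [this] at he'
    rw [he] at he'
    exact Bool.noConfusion he'
  exact hc.mono hle

/-- The cylinder event of a rooted subtree: non-loop inside edges open, boundary edges closed. -/
def subtreeCyl (ends : E → Sym2 V) (W : Finset V) : Set (Config E) :=
  {ω | (∀ e ∈ within ends (↑W : Set V), ¬ (ends e).IsDiag → ω e = true) ∧
    ∀ e ∈ boundary ends (↑W : Set V), ω e = false}

omit [Fintype E] [Fintype V] in
/-- **The cluster event of a rooted subtree of a forest is a cylinder**. -/
theorem clusterEvent_eq_subtreeCyl {ends : E → Sym2 V} (hF : Hull.IsForest ends) {s : V}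
    {W : Finset V} (hW : IsRootedSub ends s W) :
    clusterEvent ends s (↑W : Set V) = subtreeCyl ends W := by
  ext ω
  simp only [mem_clusterEvent, subtreeCyl, Set.mem_setOf_eq]
  constructor
  · intro h
    refine ⟨fun e he hnd => ?_, fun e he => ?_⟩
    · obtain ⟨x, hx, y, hy, hxy⟩ := he
      have hne : x ≠ y := by
        intro hxy'; apply hnd; rw [hxy, hxy']; exact Sym2.mk_isDiag_iff.2 rfl
      by_contra hopen
      have hclosed : ω e = false := by cases hωe : ω e <;> simp_all
      have hcx : x ∈ cluster ends ω s := by rw [h]; exact hx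
      have hcy : y ∈ cluster ends ω s := by rw [h]; exact hy
      have hc : Conn ends ω x y := conn_trans (conn_symm hcx) hcy
      exact not_conn_of_closed hF hxy hne hclosed hc
    · obtain ⟨x, hx, y, hy, hxy⟩ := he
      by_contra hopen
      have hωe : ω e = true := by cases hωe : ω e <;> simp_all
      have hcx : x ∈ cluster ends ω s := by rw [h]; exact hx
      have hne : x ≠ y := fun hxy' => hy (hxy' ▸ hx)
      have hadj : (openGraph ends ω).Adj x y := openGraph_adj.2 ⟨hne, e, hωe, hxy⟩
      have hcy : y ∈ cluster ends ω s := mem_cluster_of_adj hcx hadj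
      rw [h] at hcy
      exact hy hcy
  · rintro ⟨hin, hout⟩
    apply Set.Subset.antisymm
    · intro y hy
      by_contra hyW
      obtain ⟨w⟩ := hy
      obtain ⟨d, _, hd1, hd2⟩ := w.exists_boundary_dart (↑W : Set V) (Finset.mem_coe.mpr hW.1) hyW
      obtain ⟨_, e, he, hends⟩ := openGraph_adj.1 d.adj
      have hb : e ∈ boundary ends (↑W : Set V) := ⟨d.fst, hd1, d.snd, hd2, hends⟩
      have := hout e hb
      rw [he] at this
      exact Bool.noConfusion this
    · intro x hx
      obtain ⟨q, hq⟩ := hW.2 x (Finset.mem_coe.mp hx)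
      exact ⟨q.transfer (openGraph ends ω) fun f hf => by
        induction f using Sym2.ind with
        | h a b =>
          have hadj := q.adj_of_mem_edges hf
          obtain ⟨hne, e, _, hends⟩ := openGraph_adj.1 hadj
          have ha : a ∈ q.support := q.fst_mem_support_of_mem_edges hf
          have hb : b ∈ q.support := q.snd_mem_support_of_mem_edges hf
          have hin' : e ∈ within ends (↑W : Set V) :=
            ⟨a, Finset.mem_coe.mpr (hq a ha), b, Finset.mem_coe.mpr (hq b hb), hends⟩
          have hnd : ¬ (ends e).IsDiag := by
            rw [hends]; exact fun hd => hne (Sym2.mk_isDiag_iff.1 hd)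
          rw [SimpleGraph.mem_edgeSet, openGraph_adj]
          exact ⟨hne, e, hin e hin' hnd, hends⟩⟩

/-! ## Edge factors and the product formula -/

omit [Fintype E] [Fintype V] in
/-- With `ends e = s(x, y)`: `e` lies inside `S` iff both `x, y ∈ S`. -/
lemma mem_within_iff {ends : E → Sym2 V} {S : Set V} {e : E} {x y : V} (hxy : ends e = s(x, y)) :
    e ∈ within ends S ↔ x ∈ S ∧ y ∈ S := by
  constructor
  · rintro ⟨a, ha, b, hb, hab⟩
    rw [hxy, Sym2.eq_iff] at hab
    rcases hab with ⟨rfl, rfl⟩ | ⟨rfl, rfl⟩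
    · exact ⟨ha, hb⟩
    · exact ⟨hb, ha⟩
  · rintro ⟨hx, hy⟩
    exact ⟨x, hx, y, hy, hxy⟩

omit [Fintype E] [Fintype V] in
/-- With `ends e = s(x, y)`: `e` is a boundary edge of `S` iff exactly one endpoint lies in `S`. -/
lemma mem_boundary_iff {ends : E → Sym2 V} {S : Set V} {e : E} {x y : V} (hxy : ends e = s(x, y)) :
    e ∈ boundary ends S ↔ (x ∈ S ∧ y ∉ S) ∨ (y ∈ S ∧ x ∉ S) := by
  constructor
  · rintro ⟨a, ha, b, hb, hab⟩
    rw [hxy, Sym2.eq_iff] at hab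
    rcases hab with ⟨rfl, rfl⟩ | ⟨rfl, rfl⟩
    · exact Or.inl ⟨ha, hb⟩
    · exact Or.inr ⟨ha, hb⟩
  · rintro (⟨hx, hy⟩ | ⟨hy, hx⟩)
    · exact ⟨x, hx, y, hy, hxy⟩
    · exact ⟨y, hy, x, hx, hxy.trans (Sym2.eq_swap)⟩

omit [Fintype E] [Fintype V] in
/-- With `ends e = s(x, y)`: `e` touches `S` iff some endpoint lies in `S`. -/
lemma mem_touches_iff {ends : E → Sym2 V} {S : Set V} {e : E} {x y : V} (hxy : ends e = s(x, y)) :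
    e ∈ touches ends S ↔ x ∈ S ∨ y ∈ S := by
  constructor
  · rintro ⟨a, ha, b, hab⟩
    rw [hxy, Sym2.eq_iff] at hab
    rcases hab with ⟨rfl, rfl⟩ | ⟨rfl, rfl⟩
    · exact Or.inl ha
    · exact Or.inr ha
  · rintro (hx | hy)
    · exact ⟨x, hx, y, hxy⟩
    · exact ⟨y, hy, x, hxy.trans (Sym2.eq_swap)⟩

variable {R : Type*} [CommRing R]

/-- The edge factor of a vertex set: `p_e` inside, `1 − p_e` on the boundary, `1` otherwise (and `1`
for loops). -/
noncomputable def edgeFac (p : E → R) (ends : E → Sym2 V) (W : Finset V) (e : E) : R :=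
  if (ends e).IsDiag then 1 else
    if e ∈ within ends (↑W : Set V) then p e else
      if e ∈ boundary ends (↑W : Set V) then 1 - p e else 1

/-- The non-loop edges touching `W`. -/
noncomputable def touchF (ends : E → Sym2 V) (W : Finset V) : Finset E :=
  Finset.univ.filter fun e => ¬ (ends e).IsDiag ∧ e ∈ touches ends (↑W : Set V)

/-- The subtree cylinder as a `cylinder`. -/
lemma subtreeCyl_eq_cylinder (ends : E → Sym2 V) (W : Finset V) :
    subtreeCyl ends W = cylinder (touchF ends W) (fun e => decide (e ∈ within ends (↑W : Set V))) := by
  ext ω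
  simp only [subtreeCyl, Set.mem_setOf_eq, mem_cylinder, touchF, Finset.mem_filter, Finset.mem_univ,
    true_and]
  constructor
  · rintro ⟨hin, hout⟩ e ⟨hnd, ht⟩
    obtain ⟨⟨x, y⟩, hxy⟩ := Quot.exists_rep (ends e)
    have hxy' : ends e = s(x, y) := hxy.symm
    by_cases hw : e ∈ within ends (↑W : Set V)
    · rw [hin e hw hnd]; simp [hw]
    · have hb : e ∈ boundary ends (↑W : Set V) := by
        rw [mem_touches_iff hxy'] at ht
        rw [mem_within_iff hxy'] at hw
        rw [mem_boundary_iff hxy']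
        tauto
      rw [hout e hb]; simp [hw]
  · intro h
    refine ⟨fun e he hnd => ?_, fun e he => ?_⟩
    · have ht : e ∈ touches ends (↑W : Set V) := by
        obtain ⟨a, ha, b, _, hab⟩ := he
        exact ⟨a, ha, b, hab⟩
      have := h e ⟨hnd, ht⟩
      rw [this]; simp [he]
    · obtain ⟨⟨x, y⟩, hxy⟩ := Quot.exists_rep (ends e)
      have hxy' : ends e = s(x, y) := hxy.symm
      have hb := he
      rw [mem_boundary_iff hxy'] at hb
      have hnd : ¬ (ends e).IsDiag := by
        rw [hxy']; intro hd
        have := Sym2.mk_isDiag_iff.1 hd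
        subst this
        tauto
      have ht : e ∈ touches ends (↑W : Set V) := by rw [mem_touches_iff hxy']; tauto
      have hw : e ∉ within ends (↑W : Set V) := by rw [mem_within_iff hxy']; tauto
      have := h e ⟨hnd, ht⟩
      rw [this]; simp [hw]

/-- `P(subtreeCyl W) = ∏_e edgeFac W e`. -/
lemma prob_subtreeCyl (p : E → R) (ends : E → Sym2 V) (W : Finset V) :
    prob p (subtreeCyl ends W) = ∏ e, edgeFac p ends W e := by
  rw [subtreeCyl_eq_cylinder, prob_cylinder, touchF, Finset.prod_filter]
  refine Finset.prod_congr rfl fun e _ => ?_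
  unfold edgeFac
  by_cases hnd : (ends e).IsDiag
  · simp [hnd]
  · obtain ⟨⟨x, y⟩, hxy⟩ := Quot.exists_rep (ends e)
    have hxy' : ends e = s(x, y) := hxy.symm
    by_cases hw : e ∈ within ends (↑W : Set V)
    · have ht : e ∈ touches ends (↑W : Set V) := by
        obtain ⟨a, ha, b, _, hab⟩ := hw; exact ⟨a, ha, b, hab⟩
      simp [hnd, ht, hw]
    · by_cases hb : e ∈ boundary ends (↑W : Set V)
      · have ht : e ∈ touches ends (↑W : Set V) := by
          obtain ⟨a, ha, b, _, hab⟩ := hb; exact ⟨a, ha, b, hab⟩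
        simp [hnd, ht, hw, hb]
      · have ht : e ∉ touches ends (↑W : Set V) := by
          rw [mem_touches_iff hxy']
          rw [mem_within_iff hxy'] at hw
          rw [mem_boundary_iff hxy'] at hb
          tauto
        simp [hnd, ht, hw, hb]

/-- **The cluster law of a rooted subtree of a forest is the edge product.** -/
theorem clusterMass_eq_prod (p : E → R) {ends : E → Sym2 V} (hF : Hull.IsForest ends) {s : V}
    {W : Finset V} (hW : IsRootedSub ends s W) :
    clusterMass p ends s W = ∏ e, edgeFac p ends W e := by
  unfold clusterMass
  rw [clusterEvent_eq_subtreeCyl hF hW, prob_subtreeCyl]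

omit [Fintype V] in
/-- A set that is not a rooted subtree carries no cluster mass. -/
theorem clusterMass_eq_zero_of_not_rooted (p : E → R) (ends : E → Sym2 V) (s : V) {W : Finset V}
    (hW : ¬ IsRootedSub ends s W) : clusterMass p ends s W = 0 := by
  unfold clusterMass
  have : clusterEvent ends s (↑W : Set V) = ∅ := by
    ext ω
    simp only [Set.mem_empty_iff_false, iff_false]
    exact fun h => hW (isRootedSub_of_clusterEvent h)
  rw [this]
  simp [prob]

/-! ## Rooted subtrees of a forest: no cross edges, closure under intersection -/

omit [Fintype E] [Fintype V] in
/-- **No cross edges**: two rooted subtrees containing `s` have no edge between `W₁ ∖ W₂` and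
`W₂ ∖ W₁` (path uniqueness in the forest). -/
lemma no_cross_edge {ends : E → Sym2 V} (hF : Hull.IsForest ends) {s : V} {W₁ W₂ : Finset V}
    (h₁ : IsRootedSub ends s W₁) (h₂ : IsRootedSub ends s W₂) {x y : V}
    (hadj : (allG ends).Adj x y) (hx₁ : x ∈ W₁) (hx₂ : x ∉ W₂) (hy₂ : y ∈ W₂) (hy₁ : y ∉ W₁) :
    False := by
  obtain ⟨q₁, hq₁⟩ := h₁.2 x hx₁
  obtain ⟨q₂, hq₂⟩ := h₂.2 y hy₂
  set p₁ := q₁.toPath with hp₁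
  set p₂ := q₂.toPath with hp₂
  have hsup₁ : ∀ v ∈ (p₁ : (allG ends).Walk s x).support, v ∈ W₁ :=
    fun v hv => hq₁ v (SimpleGraph.Walk.support_toPath_subset_support q₁ hv)
  have hsup₂ : ∀ v ∈ (p₂ : (allG ends).Walk s y).support, v ∈ W₂ :=
    fun v hv => hq₂ v (SimpleGraph.Walk.support_toPath_subset_support q₂ hv)
  have hy : y ∉ (p₁ : (allG ends).Walk s x).support := fun hy => hy₁ (hsup₁ y hy)
  have hpath : ((p₁ : (allG ends).Walk s x).concat hadj).IsPath := p₁.2.concat hy hadj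
  have huniq := hF.2.path_unique ⟨(p₁ : (allG ends).Walk s x).concat hadj, hpath⟩ p₂
  have hval : (p₁ : (allG ends).Walk s x).concat hadj = (p₂ : (allG ends).Walk s y) :=
    congrArg Subtype.val huniq
  have hx : x ∈ ((p₁ : (allG ends).Walk s x).concat hadj).support := by
    rw [SimpleGraph.Walk.support_concat]
    exact List.mem_append_left _ (SimpleGraph.Walk.end_mem_support _)
  rw [hval] at hx
  exact hx₂ (hsup₂ x hx)

omit [Fintype E] [Fintype V] in
/-- The intersection of two rooted subtrees of a forest is a rooted subtree. -/
lemma inter_rooted {ends : E → Sym2 V} (hF : Hull.IsForest ends) {s : V} {W₁ W₂ : Finset V}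
    (h₁ : IsRootedSub ends s W₁) (h₂ : IsRootedSub ends s W₂) : IsRootedSub ends s (W₁ ∩ W₂) := by
  refine ⟨Finset.mem_inter.2 ⟨h₁.1, h₂.1⟩, fun x hx => ?_⟩
  obtain ⟨hx₁, hx₂⟩ := Finset.mem_inter.1 hx
  obtain ⟨q₁, hq₁⟩ := h₁.2 x hx₁
  obtain ⟨q₂, hq₂⟩ := h₂.2 x hx₂
  have huniq := hF.2.path_unique q₁.toPath q₂.toPath
  have hval : (q₁.toPath : (allG ends).Walk s x) = q₂.toPath := congrArg Subtype.val huniq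
  refine ⟨q₁.toPath, fun v hv => Finset.mem_inter.2 ⟨?_, ?_⟩⟩
  · exact hq₁ v (SimpleGraph.Walk.support_toPath_subset_support q₁ hv)
  · rw [hval] at hv
    exact hq₂ v (SimpleGraph.Walk.support_toPath_subset_support q₂ hv)

omit [Fintype E] [Fintype V] in
/-- The union of two rooted subtrees is a rooted subtree. -/
lemma union_rooted {ends : E → Sym2 V} {s : V} {W₁ W₂ : Finset V}
    (h₁ : IsRootedSub ends s W₁) (h₂ : IsRootedSub ends s W₂) : IsRootedSub ends s (W₁ ∪ W₂) := by
  refine ⟨Finset.mem_union_left _ h₁.1, fun x hx => ?_⟩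
  rcases Finset.mem_union.1 hx with hx₁ | hx₂
  · obtain ⟨q, hq⟩ := h₁.2 x hx₁
    exact ⟨q, fun v hv => Finset.mem_union_left _ (hq v hv)⟩
  · obtain ⟨q, hq⟩ := h₂.2 x hx₂
    exact ⟨q, fun v hv => Finset.mem_union_right _ (hq v hv)⟩

/-! ## Modularity of the edge factors and the theorem -/

omit [Fintype E] in
/-- **Each edge factor is modular** on a pair of rooted subtrees of a forest. -/
lemma edgeFac_mul (p : E → R) {ends : E → Sym2 V} (hF : Hull.IsForest ends) {s : V}
    {W₁ W₂ : Finset V} (h₁ : IsRootedSub ends s W₁) (h₂ : IsRootedSub ends s W₂) (e : E) :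
    edgeFac p ends W₁ e * edgeFac p ends W₂ e =
      edgeFac p ends (W₁ ∩ W₂) e * edgeFac p ends (W₁ ∪ W₂) e := by
  unfold edgeFac
  by_cases hnd : (ends e).IsDiag
  · simp [hnd]
  obtain ⟨⟨x, y⟩, hxy⟩ := Quot.exists_rep (ends e)
  have hxy' : ends e = s(x, y) := hxy.symm
  have hne : x ≠ y := by
    intro h; apply hnd; rw [hxy', h]; exact Sym2.mk_isDiag_iff.2 rfl
  have hadj : (allG ends).Adj x y := openGraph_adj.2 ⟨hne, e, rfl, hxy'⟩
  simp only [hnd, if_false, mem_within_iff hxy', mem_boundary_iff hxy', Finset.coe_inter,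
    Finset.coe_union, Set.mem_inter_iff, Set.mem_union, Finset.mem_coe]
  by_cases hx₁ : x ∈ W₁ <;> by_cases hy₁ : y ∈ W₁ <;> by_cases hx₂ : x ∈ W₂ <;> by_cases hy₂ : y ∈ W₂
  all_goals first
    | exact absurd (no_cross_edge hF h₁ h₂ hadj hx₁ hx₂ hy₂ hy₁) id
    | exact absurd (no_cross_edge hF h₁ h₂ hadj.symm hy₁ hy₂ hx₂ hx₁) id
    | (simp [hx₁, hy₁, hx₂, hy₂] <;> ring)

/-- **The cluster law of a forest is log-modular on rooted subtrees.** -/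
theorem clusterMass_mul_eq (p : E → R) {ends : E → Sym2 V} (hF : Hull.IsForest ends) {s : V}
    {W₁ W₂ : Finset V} (h₁ : IsRootedSub ends s W₁) (h₂ : IsRootedSub ends s W₂) :
    clusterMass p ends s W₁ * clusterMass p ends s W₂ =
      clusterMass p ends s (W₁ ∩ W₂) * clusterMass p ends s (W₁ ∪ W₂) := by
  rw [clusterMass_eq_prod p hF h₁, clusterMass_eq_prod p hF h₂,
    clusterMass_eq_prod p hF (inter_rooted hF h₁ h₂), clusterMass_eq_prod p hF (union_rooted h₁ h₂),
    ← Finset.prod_mul_distrib, ← Finset.prod_mul_distrib]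
  exact Finset.prod_congr rfl fun e _ => edgeFac_mul p hF h₁ h₂ e

variable [LinearOrder R] [IsStrictOrderedRing R]

/-- **`ClusterLogSupermod` on every forest**: the root-cluster law satisfies the FKG lattice
condition on `Finset V` (equality on rooted subtrees, `0 ≤ _` otherwise). -/
theorem clusterLogSupermod_of_isForest (p : E → R) (hp : IsProbVec p) {ends : E → Sym2 V}
    (hF : Hull.IsForest ends) (s : V) : ClusterLogSupermod p ends s := by
  intro W₁ W₂
  by_cases h₁ : IsRootedSub ends s W₁
  · by_cases h₂ : IsRootedSub ends s W₂
    · exact (clusterMass_mul_eq p hF h₁ h₂).le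
    · rw [clusterMass_eq_zero_of_not_rooted p ends s h₂, mul_zero]
      exact mul_nonneg (prob_nonneg hp _) (prob_nonneg hp _)
  · rw [clusterMass_eq_zero_of_not_rooted p ends s h₁, zero_mul]
    exact mul_nonneg (prob_nonneg hp _) (prob_nonneg hp _)

/-- **(SIDE) on every forest, unconditionally** (mine-1's `sideIneq_of_clusterLogSupermod`). -/
theorem sideIneq_of_isForest (p : E → R) (hp : IsProbVec p) {ends : E → Sym2 V}
    (hF : Hull.IsForest ends) (s : V) (T F : Finset V) : SideIneq p ends s T F :=
  sideIneq_of_clusterLogSupermod ends s hp (clusterLogSupermod_of_isForest p hp hF s) T F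
end ForestCluster

end Summit.Ventures.PercRepro2
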